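import Mathlib.Analysis.SpecialFunctions.Pow.Real
import HarnessLib

/-!
# Cap lemmas for the three-contact cap budget (pure real arithmetic)

HONEST FRAMING. Part of the venture `Summits/Ventures/Crystal3D` (cell `crystal3d-full`), helper
`--supports` the crux `NoReconstructionGain` (stmt-Ventures-19144, route
`route-Ventures-StickyWulffConstant`), line `adhesion` (wulff-p1 g12); bricks of the open stub
`stub_frameCapBudget` (skeleton v15), case of THREE substrate contacts above height `√(2/11)`.

Everything is in the scaled CUBIC COORDINATES of `…GrainFrameSplA`: unit vectors have coordinates
`(x, y, z)` with `x² + y² + z² = 2`, the inner product of two unit vectors is `(x x' + y y' + z z')/2`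
(so two contacts that do not overlap satisfy `x x' + y y' + z z' ≤ 1`), the twelve directions of the
fcc bond star are `(±1,±1,0), (±1,0,±1), (0,±1,±1)`, and `u` BLOCKS a direction `ε` iff `ε·u > 1`.

* `pair_cap`, `triple_cap` — Cauchy–Schwarz: two (three) pairwise non-overlapping contacts `uᵢ`
  have `|Σ uᵢ|² ≤ 6` (`≤ 12`), so a linear form `m` cannot have `(Σ m·uᵢ)² > 6|m|²` (`> 12|m|²`).
  With `m` the sum of two adjacent star directions (`|m|² = 6`, e.g. `m·u = x + y + 2z`) two contacts
  cannot both have `m·u > 3` (both within `30°` of the edge midpoint); with `m = (1,1,3)`-type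
  (`|m|² = 11`) three contacts cannot all have `m·u ≥ 4`.
* `ecell_bound` — the EDGE CELL of the arrangement of the twelve `60°`-circles: a point blocking the
  two endpoints `(0,1,1), (1,0,1)` of an edge strictly and none of `(1,1,0), (−1,0,1), (0,−1,1)` has
  `x + y + 2z > 3` and `z > 1` (it lies within `30°` of the edge midpoint; sharp exactly at the two
  endpoints, which are excluded by strictness).
* `vertex_of_blocks_only` — a point blocking `(0,1,1)` strictly and none of its four neighbours
  `(1,0,1), (1,1,0), (−1,0,1), (−1,1,0)` IS the vertex `(0,1,1)`.
* `ccell_bound`, `wcell_bound` — the WEAK REGION of an edge (edge cell, the two corner cells of the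
  adjacent square, and — under the side conditions the depth supplies — the adjacent triangle cell and
  the square's centre cell) satisfies `P + Q + 3R ≥ 4` (`(P,Q,R)` the coordinates adapted to the edge
  `(0,1,1), (1,0,1)`: the form `(1,1,3)`); all eight edges are instances by permuting / negating
  coordinates.

WHAT THIS IS NOT: the budget itself (assembled in `…GrainFrameBudgetThree*`); rung F-C1 not moved.
-/

namespace Summit.Ventures.Crystal3D.Theorems

/-! ## Cauchy–Schwarz caps -/

/-- **Two non-overlapping contacts cannot both lie in an open `30°`-type cap:** if
`x₁x₂ + y₁y₂ + z₁z₂ ≤ 1` then `(m·u₁ + m·u₂)² ≤ 6 |m|²`. -/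
theorem pair_cap {x₁ y₁ z₁ x₂ y₂ z₂ m₁ m₂ m₃ : ℝ}
    (h1 : x₁ ^ 2 + y₁ ^ 2 + z₁ ^ 2 = 2) (h2 : x₂ ^ 2 + y₂ ^ 2 + z₂ ^ 2 = 2)
    (hsep : x₁ * x₂ + y₁ * y₂ + z₁ * z₂ ≤ 1)
    (hbig : 6 * (m₁ ^ 2 + m₂ ^ 2 + m₃ ^ 2) <
      ((m₁ * x₁ + m₂ * y₁ + m₃ * z₁) + (m₁ * x₂ + m₂ * y₂ + m₃ * z₂)) ^ 2) : False := by
  have hσ : (x₁ + x₂) ^ 2 + (y₁ + y₂) ^ 2 + (z₁ + z₂) ^ 2 ≤ 6 := by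
    have e : (x₁ + x₂) ^ 2 + (y₁ + y₂) ^ 2 + (z₁ + z₂) ^ 2 =
        (x₁ ^ 2 + y₁ ^ 2 + z₁ ^ 2) + (x₂ ^ 2 + y₂ ^ 2 + z₂ ^ 2) + 2 * (x₁ * x₂ + y₁ * y₂ + z₁ * z₂) := by ring
    rw [e]; linarith
  have hms : (m₁ * x₁ + m₂ * y₁ + m₃ * z₁) + (m₁ * x₂ + m₂ * y₂ + m₃ * z₂) =
      m₁ * (x₁ + x₂) + m₂ * (y₁ + y₂) + m₃ * (z₁ + z₂) := by ring
  rw [hms] at hbig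
  -- Cauchy–Schwarz via the Lagrange identity
  have hCS : (m₁ * (x₁ + x₂) + m₂ * (y₁ + y₂) + m₃ * (z₁ + z₂)) ^ 2 ≤
      (m₁ ^ 2 + m₂ ^ 2 + m₃ ^ 2) * ((x₁ + x₂) ^ 2 + (y₁ + y₂) ^ 2 + (z₁ + z₂) ^ 2) := by
    nlinarith [sq_nonneg (m₁ * (y₁ + y₂) - m₂ * (x₁ + x₂)), sq_nonneg (m₁ * (z₁ + z₂) - m₃ * (x₁ + x₂)),
      sq_nonneg (m₂ * (z₁ + z₂) - m₃ * (y₁ + y₂))]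
  have hm0 : 0 ≤ m₁ ^ 2 + m₂ ^ 2 + m₃ ^ 2 := by positivity
  have h6 : (m₁ ^ 2 + m₂ ^ 2 + m₃ ^ 2) * ((x₁ + x₂) ^ 2 + (y₁ + y₂) ^ 2 + (z₁ + z₂) ^ 2) ≤
      (m₁ ^ 2 + m₂ ^ 2 + m₃ ^ 2) * 6 := mul_le_mul_of_nonneg_left hσ hm0
  linarith

/-- **Three pairwise non-overlapping contacts cannot all lie in an open `35.26°`-type cap:** if the
pairwise sums `xᵢxⱼ + yᵢyⱼ + zᵢzⱼ ≤ 1` then `(Σ m·uᵢ)² ≤ 12 |m|²`. -/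
theorem triple_cap {x₁ y₁ z₁ x₂ y₂ z₂ x₃ y₃ z₃ m₁ m₂ m₃ : ℝ}
    (h1 : x₁ ^ 2 + y₁ ^ 2 + z₁ ^ 2 = 2) (h2 : x₂ ^ 2 + y₂ ^ 2 + z₂ ^ 2 = 2)
    (h3 : x₃ ^ 2 + y₃ ^ 2 + z₃ ^ 2 = 2)
    (h12 : x₁ * x₂ + y₁ * y₂ + z₁ * z₂ ≤ 1) (h13 : x₁ * x₃ + y₁ * y₃ + z₁ * z₃ ≤ 1)
    (h23 : x₂ * x₃ + y₂ * y₃ + z₂ * z₃ ≤ 1)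
    (hbig : 12 * (m₁ ^ 2 + m₂ ^ 2 + m₃ ^ 2) <
      ((m₁ * x₁ + m₂ * y₁ + m₃ * z₁) + (m₁ * x₂ + m₂ * y₂ + m₃ * z₂) + (m₁ * x₃ + m₂ * y₃ + m₃ * z₃)) ^ 2) :
    False := by
  have hσ : (x₁ + x₂ + x₃) ^ 2 + (y₁ + y₂ + y₃) ^ 2 + (z₁ + z₂ + z₃) ^ 2 ≤ 12 := by
    have e : (x₁ + x₂ + x₃) ^ 2 + (y₁ + y₂ + y₃) ^ 2 + (z₁ + z₂ + z₃) ^ 2 =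
        (x₁ ^ 2 + y₁ ^ 2 + z₁ ^ 2) + (x₂ ^ 2 + y₂ ^ 2 + z₂ ^ 2) + (x₃ ^ 2 + y₃ ^ 2 + z₃ ^ 2) +
          2 * (x₁ * x₂ + y₁ * y₂ + z₁ * z₂) + 2 * (x₁ * x₃ + y₁ * y₃ + z₁ * z₃) +
          2 * (x₂ * x₃ + y₂ * y₃ + z₂ * z₃) := by ring
    rw [e]; linarith
  have hms : (m₁ * x₁ + m₂ * y₁ + m₃ * z₁) + (m₁ * x₂ + m₂ * y₂ + m₃ * z₂) + (m₁ * x₃ + m₂ * y₃ + m₃ * z₃) =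
      m₁ * (x₁ + x₂ + x₃) + m₂ * (y₁ + y₂ + y₃) + m₃ * (z₁ + z₂ + z₃) := by ring
  rw [hms] at hbig
  have hCS : (m₁ * (x₁ + x₂ + x₃) + m₂ * (y₁ + y₂ + y₃) + m₃ * (z₁ + z₂ + z₃)) ^ 2 ≤
      (m₁ ^ 2 + m₂ ^ 2 + m₃ ^ 2) * ((x₁ + x₂ + x₃) ^ 2 + (y₁ + y₂ + y₃) ^ 2 + (z₁ + z₂ + z₃) ^ 2) := by
    nlinarith [sq_nonneg (m₁ * (y₁ + y₂ + y₃) - m₂ * (x₁ + x₂ + x₃)),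
      sq_nonneg (m₁ * (z₁ + z₂ + z₃) - m₃ * (x₁ + x₂ + x₃)),
      sq_nonneg (m₂ * (z₁ + z₂ + z₃) - m₃ * (y₁ + y₂ + y₃))]
  have hm0 : 0 ≤ m₁ ^ 2 + m₂ ^ 2 + m₃ ^ 2 := by positivity
  have h12' : (m₁ ^ 2 + m₂ ^ 2 + m₃ ^ 2) * ((x₁ + x₂ + x₃) ^ 2 + (y₁ + y₂ + y₃) ^ 2 + (z₁ + z₂ + z₃) ^ 2) ≤
      (m₁ ^ 2 + m₂ ^ 2 + m₃ ^ 2) * 12 := mul_le_mul_of_nonneg_left hσ hm0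
  linarith

/-! ## Cells of the arrangement of the twelve `60°`-circles -/

/-- **The edge cell lies within `30°` of the edge midpoint.**  A point blocking `(0,1,1)` and `(1,0,1)`
strictly (`q + r > 1`, `p + r > 1`) and none of `(1,1,0), (−1,0,1), (0,−1,1)` has `p + q + 2r > 3` and
`r > 1`. -/
theorem ecell_bound {p q r : ℝ} (hs : p ^ 2 + q ^ 2 + r ^ 2 = 2) (h1 : 1 < q + r) (h2 : 1 < p + r)
    (h3 : p + q ≤ 1) (h4 : r - p ≤ 1) (h5 : r - q ≤ 1) : 3 < p + q + 2 * r ∧ 1 < r := by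
  -- first `r > 1`
  have hr : 1 < r := by
    by_contra hr; push Not at hr
    have hp : 0 < p := by linarith
    have hq : 0 < q := by linarith
    have hr1 : -1 ≤ r := by nlinarith [sq_nonneg q, sq_nonneg r]
    -- `p² + q² < (p+q)² ≤ 1 ≤ 2 - r²`
    nlinarith [mul_pos hp hq]
  refine ⟨?_, hr⟩
  have hp : 0 < p := by linarith
  have hq : 0 < q := by linarith
  by_contra h; push Not at h
  -- `s := p + q ≤ 3 - 2r`, `p, q ≥ r - 1`
  have hpq : 0 ≤ (p - (r - 1)) * (q - (r - 1)) := mul_nonneg (by linarith) (by linarith)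
  have hr54 : r ≤ 5 / 4 := by linarith
  -- `(p+q)² - 2(r-1)(p+q) ≥ 4r - 3r²` and `p + q ≤ 3 - 2r`
  nlinarith [mul_nonneg (show (0:ℝ) ≤ 3 - 2 * r - (p + q) by linarith) (show (0:ℝ) ≤ (p + q) + (3 - 2 * r) - 2 * (r - 1) by linarith)]

/-- **Only the vertex blocks itself and none of its neighbours.**  A point blocking `(0,1,1)` strictly
and none of `(1,0,1), (1,1,0), (−1,0,1), (−1,1,0)` is `(0,1,1)`. -/
theorem vertex_of_blocks_only {p q r : ℝ} (hs : p ^ 2 + q ^ 2 + r ^ 2 = 2) (h1 : 1 < q + r)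
    (h2 : p + r ≤ 1) (h3 : p + q ≤ 1) (h4 : r - p ≤ 1) (h5 : q - p ≤ 1) : p = 0 ∧ q = 1 ∧ r = 1 := by
  rcases le_or_gt 0 p with hp | hp
  · -- `q, r ≤ 1 - p`
    have hp0 : p = 0 := by
      by_contra hne
      have hp' : 0 < p := lt_of_le_of_ne hp (Ne.symm hne)
      have hq0 : 0 < q := by linarith
      have hr0 : 0 < r := by linarith
      -- `2 - p² = q² + r² ≤ 2(1-p)²` gives `p(3p - 4) ≥ 0`, so `p ≥ 4/3`, contradicting `q ≤ 1 - p`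
      have hq1 : q ^ 2 ≤ (1 - p) ^ 2 := by nlinarith
      have hr1 : r ^ 2 ≤ (1 - p) ^ 2 := by nlinarith
      nlinarith
    subst hp0
    have hq1 : q ≤ 1 := by linarith
    have hr1 : r ≤ 1 := by linarith
    refine ⟨rfl, ?_, ?_⟩ <;> nlinarith
  · exfalso
    -- `q, r ≤ 1 + p` with `p < 0`
    have hq0 : 0 < q := by linarith
    have hr0 : 0 < r := by linarith
    have hq1 : q ^ 2 ≤ (1 + p) ^ 2 := by nlinarith
    have hr1 : r ^ 2 ≤ (1 + p) ^ 2 := by nlinarith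
    nlinarith

/-- **The corner cell.**  A point blocking `(0,1,1), (1,0,1)` and `(0,−1,1)` strictly but not
`(−1,0,1)` has `P + Q + 3R ≥ 4` (sharp at `(1,0,1)` and at `(1/3,−1/3,4/3)`). -/
theorem ccell_bound {P Q R : ℝ} (hs : P ^ 2 + Q ^ 2 + R ^ 2 = 2) (h1 : 1 < Q + R) (h2 : 1 < P + R)
    (h5 : 1 < R - Q) (h4 : R - P ≤ 1) : 4 ≤ P + Q + 3 * R := by
  have hR : 1 < R := by linarith
  have hP : 0 < P := by linarith
  rcases le_or_gt (4 / 3) R with hR43 | hR43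
  · -- `P ≥ R - 1`, `Q > 1 - R`
    linarith
  · by_contra h; push Not at h
    have hx : P < 4 - Q - 3 * R := by linarith
    have hpos : 0 < 4 - Q - 3 * R := by linarith
    have hP2 : P ^ 2 < (4 - Q - 3 * R) ^ 2 := by nlinarith
    -- `φ(Q) := 2Q² + (6R-8)Q + 10R² - 24R + 14 > 0`, but
    -- `φ(Q) = 2(Q-1+R)(Q-R+1) + 2(3R-4)(Q+2R-2) < 0` on `1 - R < Q < R - 1`, `R < 4/3`.
    have hφ : 0 < 2 * Q ^ 2 + (6 * R - 8) * Q + 10 * R ^ 2 - 24 * R + 14 := by nlinarith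
    have hA : (Q - 1 + R) * (Q - R + 1) < 0 := mul_neg_of_pos_of_neg (by linarith) (by linarith)
    have hB : (3 * R - 4) * (Q + 2 * R - 2) < 0 := mul_neg_of_neg_of_pos (by linarith) (by linarith)
    nlinarith

/-- **The weak region of an edge satisfies `P + Q + 3R ≥ 4`.**  Coordinates adapted to the edge
`(0,1,1), (1,0,1)` (square about `+R` with further corners `(−1,0,1), (0,−1,1)`, triangle with third
vertex `(1,1,0)`): a point blocking both endpoints strictly, blocking the triangle's third vertex only
if `R > 1`, and blocking both further square corners only if `P + Q ≥ 0`, has `P + Q + 3R ≥ 4`. -/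
theorem wcell_bound {P Q R : ℝ} (hs : P ^ 2 + Q ^ 2 + R ^ 2 = 2) (h1 : 1 < Q + R) (h2 : 1 < P + R)
    (h3 : P + Q ≤ 1 ∨ 1 < R) (h4 : R - P ≤ 1 ∨ R - Q ≤ 1 ∨ 0 ≤ P + Q) : 4 ≤ P + Q + 3 * R := by
  by_cases hPQ : P + Q ≤ 1
  · -- the two one-sided cases
    have caseP : R - P ≤ 1 → 4 ≤ P + Q + 3 * R := by
      intro hP
      by_cases hQ : R - Q ≤ 1
      · obtain ⟨hb, hr⟩ := ecell_bound hs h1 h2 hPQ hP hQ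
        linarith
      · push Not at hQ
        exact ccell_bound hs h1 h2 hQ hP
    have caseQ : R - Q ≤ 1 → 4 ≤ P + Q + 3 * R := by
      intro hQ
      by_cases hP : R - P ≤ 1
      · exact caseP hP
      · push Not at hP
        have hs' : Q ^ 2 + P ^ 2 + R ^ 2 = 2 := by linarith
        have := ccell_bound hs' h2 h1 hP hQ
        linarith
    rcases h4 with h | h | h
    · exact caseP h
    · exact caseQ h
    · by_cases hP : R - P ≤ 1
      · exact caseP hP
      by_cases hQ : R - Q ≤ 1
      · exact caseQ hQ
      push Not at hP hQ
      -- the square's centre cell: `R > 1 + |P|, 1 + |Q|` gives `R > 4/3`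
      have hR1 : 1 < R := by linarith
      have hPa : P ^ 2 < (R - 1) ^ 2 := by nlinarith
      have hQa : Q ^ 2 < (R - 1) ^ 2 := by nlinarith
      have hR : 4 / 3 < R := by nlinarith
      linarith
  · push Not at hPQ
    rcases h3 with h | h
    · exact absurd h (not_le.2 hPQ)
    · linarith

end Summit.Ventures.Crystal3D.Theorems
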